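import Literature.AnabelianGeometry.EtaleTheta.LogDivisorModelTateTowerKummerTwistGroupR

/-!
# [EtTh] Def. 3.3 (i)(c)/(ii) v3: the COMPATIBLE part `Ẑ(1)^r ⋊ Ẑˣ × ℤ_γ` of the ζ-twisted Kummer–Tate group with `r`
# Kummer classes per level, and its levels («GRP₃» = `r = 3`, compatible part)

S. Mochizuki, *The étale theta function …*, Publ. RIMS **45** (2009) [MochizukiEtTh2009], §1 p.13 (the constant field acts on
`N`-th roots through the cyclotomic character, compatibly in `N`), §3 Def. 3.3 (i)(c) p.72, (ii) p.73
[cite: MochizukiEtTh2009, Def 3.3 (ii) p.73].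

CLASS (b) DESIGN MODEL, sequel of `LogDivisorModelTateTowerKummerTwistGroupR.lean` (abc-iut cell, layer L2; abc-iut-L2-lead gen 6
R849/R852: TATE TOWER v3 piece 2b(ii) «GRP₃», GROUP SIDE, file 2 of 2; seat abc-iut-L1-t6 g5) — the `r`-coordinate generalisation
of THIS LINEAGE's `r = 2` file `LogDivisorModelTateTowerKummerTwistCompat.lean` (p472997 — UNTOUCHED; `res`, `resC`, `M_dvd`,
`natCast_factorial_eq_zero_iff` consumed BY NAME).  The group `TateTowerKummerTwistR.Grp r = (∏_n (ℤ/M_n)^r ⋊_χ ∏_n (ℤ/M_n)ˣ) × ℤ_γ`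
carries NO compatibility between levels; the tower laws of Def. 3.3 (iii) (equivariance `resFn_act` of the pull-backs
`Z_∞^{(j)} → Z_∞^{(i)}` — pieces 2b-action / 2c of the tower lineage) hold exactly on the CLOSED SUBGROUP of compatible
families — `k_j ≡ k_i` on each of the `r` classes, `χ_j(c) ≡ χ_i(c) (mod M_i)` for `i ≤ j` — i.e. on `Ẑ(1)^r ⋊ Ẑˣ × ℤ_γ`
with `Ẑˣ` acting through THE cyclotomic character.  This file supplies it:
* `resK r h : (ℤ/M_j)^r → (ℤ/M_i)^r` (coordinatewise `res`), `resK_smul` (the twist is compatible with restriction);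
* **`compat r : Subgroup (Grp r)`** (closed under the twisted multiplication because `χ` acts by ring multiplication),
  `isClosed_compat`;
* `Compat r := ↥(compat r)` (subspace topology; a topological group by Mathlib's subtype instances), the level subgroups
  `closureC r n := Δ_n ∩ compat` — NORMAL, nested, PAIRWISE DISTINCT when `r ≠ 0` (`natElt r j` = the integer `(j+1)!` on
  every class, an element of the diagonal `ℤ ⊂ Ẑ(1)`; `natElt_mem_closureC_iff`, `le_of_closureC_le`), every open
  neighbourhood of `1` containing one of them (`exists_closureC_subset_of_isOpen`);
* **`levelsC r : LevelSystem (Compat r)`, both laws PROVED** (conjugate stabilisers + normality, as in the parent file);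
  `r = 3`: `Compat₃`, `levelsC_three_le_of_closure_le`.
HONEST LABEL: a combinatorial design model for the v2/v3 interfaces, NOT the tempered fundamental group of a Tate curve; no new
instance (the subtype instances are Mathlib's); nothing here bears on [IUTchIII] Cor. 3.12; no side taken; typed ≠ proved.
-/

noncomputable section

namespace Literature.AnabelianGeometry.EtaleTheta

open CategoryTheory Function Literature.AlgebraicGeometry.Frobenioids
  Literature.AlgebraicGeometry.Frobenioids.QuasiTemperoid Literature.AnabelianGeometry.SemiGraphs

namespace TateTowerKummerTwistR

open TateTowerKummerTwist (M one_lt_M Cst M_dvd res resC natCast_factorial_eq_zero_iff)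

variable (r : ℕ)

/-! ## Restriction between levels on `r` classes -/

/-- Restriction `(ℤ/M_j)^r → (ℤ/M_i)^r` (`i ≤ j`) on the `r` Kummer classes of one index, coordinatewise.
[cite: MochizukiEtTh2009, Def 3.3 (ii) p.73] -/
def resK {i j : ℕ} (h : i ≤ j) : (Fin r → ZMod (M j)) →+ (Fin r → ZMod (M i)) where
  toFun k a := res h (k a)
  map_zero' := funext fun a => by rw [Pi.zero_apply, Pi.zero_apply, map_zero]
  map_add' k k' := funext fun a => by rw [Pi.add_apply, Pi.add_apply, map_add]

/-- `resK` on a class. [cite: MochizukiEtTh2009, Def 3.3 (ii) p.73] -/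
@[simp] theorem resK_apply {i j : ℕ} (h : i ≤ j) (k : Fin r → ZMod (M j)) (a : Fin r) : resK r h k a = res h (k a) := rfl

/-- The twist commutes with restriction: `res (χ_j(c) · k) = χ_i(c) · res k` when `χ_i(c) = res χ_j(c)`, on all `r` classes.
[cite: MochizukiEtTh2009, §1 p.13] -/
theorem resK_smul {i j : ℕ} (h : i ≤ j) (u : (ZMod (M j))ˣ) (k : Fin r → ZMod (M j)) :
    resK r h (u • k) = resC h u • resK r h k := by
  funext a
  change res h ((u : ZMod (M j)) * k a) = (res h (u : ZMod (M j))) * res h (k a)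
  rw [map_mul]

/-! ## The compatible subgroup -/

/-- **The compatible subgroup `Ẑ(1)^r ⋊ Ẑˣ × ℤ_γ ≤ Grp r`**: families of Kummer coordinates (each of the `r` classes) and of
values of the cyclotomic character compatible under restriction between levels (a subgroup: restriction is additive and
multiplicative, and the twist is compatible with it, `resK_smul`). [cite: MochizukiEtTh2009, §1 p.13] -/
def compat : Subgroup (Grp r) where
  carrier := {g | (∀ i j (h : i ≤ j), resK r h (g.1.left.toAdd j) = g.1.left.toAdd i) ∧
    ∀ i j (h : i ≤ j), resC h (g.1.right j) = g.1.right i}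
  one_mem' := ⟨fun i j h => by rw [Prod.fst_one, SemidirectProduct.one_left, toAdd_one, Pi.zero_apply, Pi.zero_apply,
      map_zero], fun i j h => by rw [Prod.fst_one, SemidirectProduct.one_right, Pi.one_apply, Pi.one_apply, map_one]⟩
  mul_mem' := by
    rintro a b ⟨ha, ha'⟩ ⟨hb, hb'⟩
    refine ⟨fun i j h => ?_, fun i j h => ?_⟩
    · rw [toAdd_left_mul, toAdd_left_mul, map_add, resK_smul, ha i j h, hb i j h, ha' i j h]
    · rw [Prod.fst_mul, SemidirectProduct.mul_right, Pi.mul_apply, Pi.mul_apply, map_mul, ha' i j h, hb' i j h]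
  inv_mem' := by
    rintro a ⟨ha, ha'⟩
    refine ⟨fun i j h => ?_, fun i j h => ?_⟩
    · rw [toAdd_left_inv, toAdd_left_inv, resK_smul, map_neg, map_inv, ha i j h, ha' i j h]
    · rw [Prod.fst_inv, SemidirectProduct.inv_right, Pi.inv_apply, Pi.inv_apply, map_inv, ha' i j h]

/-- Membership in `compat r`. [cite: MochizukiEtTh2009, §1 p.13] -/
theorem mem_compat_iff (g : Grp r) : g ∈ compat r ↔
    (∀ i j (h : i ≤ j), resK r h (g.1.left.toAdd j) = g.1.left.toAdd i) ∧
      ∀ i j (h : i ≤ j), resC h (g.1.right j) = g.1.right i := Iff.rfl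

/-- The Kummer coordinates of index `j` depend continuously on `g ∈ Grp r`. [cite: MochizukiEtTh2009, Def 3.3 (ii) p.73] -/
theorem continuous_coordK (j : ℕ) : Continuous fun g : Grp r => g.1.left.toAdd j :=
  (continuous_apply j).comp (continuous_toAdd.comp
    ((SettingModel.Semidirect.continuous_left (isInducing_leftRight r)).comp continuous_fst))

/-- The constant-field coordinate of index `j` depends continuously on `g ∈ Grp r`. [cite: MochizukiEtTh2009, §1 p.13] -/
theorem continuous_coordC (j : ℕ) : Continuous fun g : Grp r => g.1.right j :=
  (continuous_apply j).comp ((SettingModel.Semidirect.continuous_right (isInducing_leftRight r)).comp continuous_fst)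

/-- **`compat r` is closed** (an intersection of equalisers of continuous maps into discrete spaces).
[cite: MochizukiEtTh2009, §1 p.13] -/
theorem isClosed_compat : IsClosed (compat r : Set (Grp r)) := by
  change IsClosed {g : Grp r | (∀ i j (h : i ≤ j), resK r h (g.1.left.toAdd j) = g.1.left.toAdd i) ∧
    ∀ i j (h : i ≤ j), resC h (g.1.right j) = g.1.right i}
  simp only [Set.setOf_and, Set.setOf_forall]
  refine IsClosed.inter (isClosed_iInter fun i => isClosed_iInter fun j => isClosed_iInter fun h => isClosed_eq ?_ ?_)
    (isClosed_iInter fun i => isClosed_iInter fun j => isClosed_iInter fun h => isClosed_eq ?_ ?_)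
  · exact continuous_of_discreteTopology.comp (continuous_coordK r j)
  · exact continuous_coordK r i
  · exact continuous_of_discreteTopology.comp (continuous_coordC r j)
  · exact continuous_coordC r i

/-- The compatible group `Ẑ(1)^r ⋊ Ẑˣ × ℤ_γ` as a topological group (subspace topology).
[cite: MochizukiEtTh2009, §1 p.13] -/
abbrev Compat : Type := ↥(compat r)

/-! ## Level subgroups of the compatible group -/

/-- `Δ_n ∩ compat`, the level-`n` subgroup of the compatible group. [cite: MochizukiEtTh2009, Def 3.3 (i) p.72] -/
def closureC (n : ℕ) : Subgroup (Compat r) := (closure r n).subgroupOf (compat r)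

/-- Membership in `closureC r n`. [cite: MochizukiEtTh2009, Def 3.3 (i) p.72] -/
theorem mem_closureC_iff (n : ℕ) (g : Compat r) : g ∈ closureC r n ↔ (g : Grp r) ∈ closure r n := Subgroup.mem_subgroupOf

/-- `closureC r n` is normal. [cite: MochizukiEtTh2009, Def 3.3 (i) p.72] -/
theorem closureC_normal (n : ℕ) : (closureC r n).Normal := by
  refine ⟨fun g hg h => ?_⟩
  rw [mem_closureC_iff] at hg ⊢
  rw [Subgroup.coe_mul, Subgroup.coe_mul, Subgroup.coe_inv]
  exact (closure_normal r n).conj_mem _ hg _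

/-- The `closureC r n` are nested. [cite: MochizukiEtTh2009, Def 3.3 (i) p.72] -/
theorem closureC_antitone {n m : ℕ} (h : n ≤ m) : closureC r m ≤ closureC r n :=
  fun g hg => (mem_closureC_iff r n g).2 (closure_antitone r h ((mem_closureC_iff r m g).1 hg))

/-- **Every open neighbourhood of `1` in the compatible group contains some `closureC r n`** (trace of the parent statement).
[cite: MochizukiEtTh2009, Def 3.3 (i) p.72] -/
theorem exists_closureC_subset_of_isOpen {U : Set (Compat r)} (hU : IsOpen U) (h1 : (1 : Compat r) ∈ U) :
    ∃ n, (closureC r n : Set (Compat r)) ⊆ U := by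
  obtain ⟨V, hV, hVU⟩ := isOpen_induced_iff.1 hU
  have h1V : (1 : Grp r) ∈ V := by
    have : (1 : Compat r) ∈ Subtype.val ⁻¹' V := by rw [hVU]; exact h1
    exact this
  obtain ⟨n, hn⟩ := exists_closure_subset_of_isOpen r hV h1V
  refine ⟨n, fun g hg => ?_⟩
  rw [← hVU]
  exact hn ((mem_closureC_iff r n g).1 hg)

/-- The diagonal element of the compatible group attached to the integer `(j+1)!` on EVERY Kummer class (an element of
`ℤ ⊂ Ẑ(1)` on each class; compatible because restriction fixes integers). [cite: MochizukiEtTh2009, Def 3.3 (ii) p.73] -/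
def natElt (j : ℕ) : Compat r :=
  ⟨ofKum r (Multiplicative.ofAdd fun n _ => (((j + 1).factorial : ℕ) : ZMod (M n))), by
    refine ⟨fun i i' h => ?_, fun i i' h => ?_⟩
    · rw [ofKum, SemidirectProduct.left_inl, toAdd_ofAdd]
      exact funext fun _ => map_natCast (res h) _
    · rw [ofKum, SemidirectProduct.right_inl, Pi.one_apply, Pi.one_apply, map_one]⟩

/-- `natElt r j ∈ closureC r m ↔ m ≤ j` (for `r ≠ 0`; `(j+1)!` vanishes in `ℤ/M_i` exactly for `i < j`).
[cite: MochizukiEtTh2009, Def 3.3 (i) p.72] -/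
theorem natElt_mem_closureC_iff [NeZero r] (j m : ℕ) : natElt r j ∈ closureC r m ↔ m ≤ j := by
  rw [mem_closureC_iff, natElt, ofKum_mem_closure_iff]
  simp only [toAdd_ofAdd]
  constructor
  · intro h
    by_contra hm
    have h0 := congrArg (fun f => f (0 : Fin r)) (h j (lt_of_not_ge hm))
    simp only [Pi.zero_apply, natCast_factorial_eq_zero_iff] at h0
    exact lt_irrefl j h0
  · intro h i hi
    exact funext fun _ => (natCast_factorial_eq_zero_iff i j).2 (lt_of_lt_of_le hi h)

/-- `closureC r j ≤ closureC r i` forces `i ≤ j` when `r ≠ 0`: the levels stay pairwise distinct inside the compatible group.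
[cite: MochizukiEtTh2009, Def 3.3 (i) p.72] -/
theorem le_of_closureC_le [NeZero r] {i j : ℕ} (h : closureC r j ≤ closureC r i) : i ≤ j :=
  (natElt_mem_closureC_iff r j i).1 (h ((natElt_mem_closureC_iff r j j).2 le_rfl))

/-! ## The level of a connected tempered `Compat r`-set -/

/-- A point of a tempered `Compat r`-set is fixed by some `closureC r n`. [cite: MochizukiEtTh2009, Def 3.3 (ii) p.73] -/
theorem exists_closureC_fix (T : BTemp (Compat r)) (y : T.obj.V) : ∃ n, ∀ g ∈ closureC r n, T.obj.ρ g y = y := by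
  obtain ⟨n, hn⟩ := exists_closureC_subset_of_isOpen r (T.property.2 y) (BTempConnected.ρ_one_apply T y)
  exact ⟨n, fun g hg => hn hg⟩

/-- For a CONNECTED tempered `Compat r`-set one `closureC r n` fixes every point (one orbit, conjugate stabilisers, normality).
[cite: MochizukiEtTh2009, Def 3.3 (ii) p.73] -/
theorem exists_closureC_fixes (Y : ConnectedPart (BTemp (Compat r))) :
    ∃ n, ∀ g ∈ closureC r n, ∀ y : Y.obj.obj.V, Y.obj.obj.ρ g y = y := by
  obtain ⟨y₀⟩ := BTempConnected.nonempty_of_isConnectedObj Y.obj Y.property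
  obtain ⟨n, hn⟩ := exists_closureC_fix r Y.obj y₀
  refine ⟨n, fun g hg y => ?_⟩
  obtain ⟨h, rfl⟩ := BTempConnected.exists_ρ_eq_of_isConnectedObj Y.obj Y.property y₀ y
  have hc : h⁻¹ * g * h⁻¹⁻¹ ∈ closureC r n := (closureC_normal r n).conj_mem g hg h⁻¹
  rw [inv_inv] at hc
  rw [← BTempConnected.ρ_mul_apply, show g * h = h * (h⁻¹ * g * h) by
      rw [← mul_assoc, ← mul_assoc, mul_inv_cancel, one_mul],
    BTempConnected.ρ_mul_apply, hn _ hc]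

/-- The level of a connected tempered `Compat r`-set: the least `n` with `closureC r n` acting trivially.
[cite: MochizukiEtTh2009, Def 3.3 (ii) p.73] -/
def lvlC (Y : ConnectedPart (BTemp (Compat r))) : ℕ :=
  sInf {n | ∀ g ∈ closureC r n, ∀ y : Y.obj.obj.V, Y.obj.obj.ρ g y = y}

/-- `closureC r (lvlC r Y)` fixes `Y`. [cite: MochizukiEtTh2009, Def 3.3 (i) p.72] -/
theorem closureC_lvlC_fixes (Y : ConnectedPart (BTemp (Compat r))) :
    ∀ g ∈ closureC r (lvlC r Y), ∀ y : Y.obj.obj.V, Y.obj.obj.ρ g y = y :=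
  Nat.sInf_mem (s := {n | ∀ g ∈ closureC r n, ∀ y : Y.obj.obj.V, Y.obj.obj.ρ g y = y}) (exists_closureC_fixes r Y)

/-- Minimality of the level. [cite: MochizukiEtTh2009, Def 3.3 (i) p.72] -/
theorem lvlC_le {Y : ConnectedPart (BTemp (Compat r))} {n : ℕ}
    (h : ∀ g ∈ closureC r n, ∀ y : Y.obj.obj.V, Y.obj.obj.ρ g y = y) : lvlC r Y ≤ n :=
  Nat.sInf_le h

/-- Levels are monotone along covering maps. [cite: MochizukiEtTh2009, Def 3.3 (i) p.72] -/
theorem lvlC_le_of_hom {Y Y' : ConnectedPart (BTemp (Compat r))} (f : Y' ⟶ Y) : lvlC r Y ≤ lvlC r Y' := by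
  obtain ⟨y'₀⟩ := BTempConnected.nonempty_of_isConnectedObj Y'.obj Y'.property
  refine lvlC_le r fun g hg y => ?_
  obtain ⟨y', rfl⟩ := BTempConnected.surjective_of_isConnectedObj y'₀ Y.property f.hom y
  rw [← BTempConnected.hom_ρ, closureC_lvlC_fixes r Y' g hg y']

/-- **The level structure of the compatible ζ-twisted Kummer–Tate group `Ẑ(1)^r ⋊ Ẑˣ × ℤ_γ`** (Def. 3.3 (i)(c)/(ii)): levels
`ℕ`, normal `closureC r n`, `lvlC`; BOTH laws PROVED — the `LevelSystem` over which a tower with `r` Kummer classes per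
level is equivariant. [cite: MochizukiEtTh2009, Def 3.3 (i) p.72] -/
def levelsC : LevelSystem (Compat r) where
  I := ℕ
  closure := closureC r
  closure_normal := closureC_normal r
  lvl := lvlC r
  closure_lvl_act Y g hg y := closureC_lvlC_fixes r Y g hg y
  closure_lvl_mono f := closureC_antitone r (lvlC_le_of_hom r f)

/-- The levels of `levelsC r` are linearly ordered by their closures (`r ≠ 0`). [cite: MochizukiEtTh2009, Def 3.3 (ii) p.73] -/
theorem levelsC_le_of_closure_le [NeZero r] {i j : ℕ} (h : (levelsC r).closure j ≤ (levelsC r).closure i) : i ≤ j :=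
  le_of_closureC_le r h

/-- `closureC r m ≤ closureC r n` forces the index-wise vanishing used by tower transition maps: an element of `closureC r m`
has ALL `r` Kummer coordinates of index `< m` trivial, trivial character and trivial translation (restatement-free
projection of `mem_closure_iff` to the compatible group). [cite: MochizukiEtTh2009, Def 3.3 (i) p.72] -/
theorem coord_eq_zero_of_mem_closureC {m : ℕ} {g : Compat r} (hg : g ∈ closureC r m) (i : ℕ) (hi : i < m) :
    (g : Grp r).1.left.toAdd i = 0 :=
  ((mem_closure_iff r m (g : Grp r)).1 ((mem_closureC_iff r m g).1 hg)).2.2 i hi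

/-- On the compatible group the index-`j` character value restricts to the index-`i` one (`i ≤ j`) — the hypothesis under
which level inflation of roots of unity is equivariant (this lineage's `inflate_smul_iff_res_eq`, p475183).
[cite: MochizukiEtTh2009, §1 p.13] -/
theorem resC_right_eq (g : Compat r) {i j : ℕ} (h : i ≤ j) : resC h ((g : Grp r).1.right j) = (g : Grp r).1.right i :=
  g.2.2 i j h

/-- On the compatible group the index-`j` Kummer classes restrict to the index-`i` ones (`i ≤ j`), class by class.
[cite: MochizukiEtTh2009, Def 3.3 (ii) p.73] -/
theorem res_coord_eq (g : Compat r) {i j : ℕ} (h : i ≤ j) (a : Fin r) :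
    res h ((g : Grp r).1.left.toAdd j a) = (g : Grp r).1.left.toAdd i a :=
  congrArg (fun f => f a) (g.2.1 i j h)

/-! ## `r = 3` -/

/-- **The compatible part `Ẑ(1)³ ⋊ Ẑˣ × ℤ_γ` of «GRP₃»** (roots of `ϖ̈`, `Ü`, `Θ̈`). [cite: MochizukiEtTh2009, Def 3.3 (ii) p.73] -/
abbrev Compat₃ : Type := Compat 3

/-- The level structure of `Compat₃`, levels pairwise distinct. [cite: MochizukiEtTh2009, Def 3.3 (i) p.72] -/
theorem levelsC_three_le_of_closure_le {i j : ℕ} (h : (levelsC 3).closure j ≤ (levelsC 3).closure i) : i ≤ j :=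
  levelsC_le_of_closure_le 3 h

end TateTowerKummerTwistR

end Literature.AnabelianGeometry.EtaleTheta

end
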